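import Summits.Parity.GeneralizedHardyLittlewood.Theorems.PrimeLevelFamEdgeMomentsBeyondDiagonalDiagBoseMixedStructure
import Summits.Parity.GeneralizedHardyLittlewood.Theorems.PrimeLevelFamEdgeMomentsBeyondDiagonalDiagBoseMixedTail
import Summits.Parity.GeneralizedHardyLittlewood.Theorems.PrimeLevelFamEdgeMomentsBeyondDiagonalDiagBoseDecay
import Mathlib.Algebra.Ring.GeomSum
import HarnessLib

/-!
# Route `PrimeLevelFamEdge`, crux K_A `MomentsBeyondDiagonal` (stmt-Parity-20007), line «petersson_layers» v4, stub `stub_diag`: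
# **census R2 — the Bose remainder CONTINUED TO `[1, ∞)`: size and variation**

In the corner/Abel step the polynomial main term `P_ab(log(1/y))` of `…DiagBoseMixedStructure.bose_coeff_structure` is used at
EVERY argument `y = αk₁k₂` (also `y > 1`, where `log(1/y) < 0`), exactly as K_B's `kmvKernel` continues `½log(Q²/K)` and
`cornerE = 𝒲 − ½log(1/y)` absorbs the difference (`cornerE_le_log`). For the continued remainder
`r_ab(y) = c_ab(y) − c_ab(1) − A_ab − Π_ab(y)`, `Π_ab(y) = Σ_{i,j}C(a,i)C(b,j)((−1)^j+(−1)^i)μ_{i+j}(−1/2)^pL^{p+1}/(p+1)`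
(`L = log(1/y)`, `p = a−i+b−j`), on `y ≥ 1`:

* `abs_pow_sub_pow_le_of_abs_le` — `|u^n − v^n| ≤ n m^{n−1}|u − v|` for `|u|,|v| ≤ m`;
* `abs_polyPart_le` / `abs_polyPart_sub_le` — `|Π_ab(y)| ≤ C(1+log y)^{a+b+1}`,
  `|Π_ab(y₁) − Π_ab(y₂)| ≤ C(1+log y₂)^{a+b+1}(y₂−y₁)/y₁` (`1 ≤ y₁ ≤ y₂`);
* `abs_bose_rem_tail_le` — **`|r_ab(y)| ≤ C(1+log y)^{a+b+1}`** (`y ≥ 1`);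
* `abs_bose_rem_tail_sub_le` — **`|r_ab(y₁) − r_ab(y₂)| ≤ C(1+log y₂)^{a+b+1}(y₂−y₁)/y₁`** (`1 ≤ y₁ ≤ y₂`) — the hypotheses
  of `…DiagCornerAbelRay.sum_abs_sub_le_of_lipschitz_inv` / the `(G, V)` side of `…DiagCornerAbelBVTwoVar.abs_doubleSum_bv_pow_le`.

Def-free; theorems only. Helper `--supports stmt-Parity-20007`; closes nothing; K_A, K_B and the Parity summit are NOT
proved; nothing about Landau–Siegel zeros.

## References
* E. Kowalski, P. Michel, J. VanderKam, J. reine angew. Math. 526 (2000), (22)–(28) pp. 12–15 and Prop. 5.1 p. 18.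
  [cite: KowalskiMichelVanderKam2000, (22)–(28) — derivation (remainder of the diagonal weight beyond the box)]
-/

noncomputable section

open Real Set MeasureTheory Filter Function Finset

namespace Summit.Parity.GeneralizedHardyLittlewood.Theorems.MomentsBeyondDiagonal.DiagLines

/-- `|u^n − v^n| ≤ n·m^{n−1}·|u − v|` when `|u|, |v| ≤ m`. [folklore] -/
theorem abs_pow_sub_pow_le_of_abs_le {u v m : ℝ} (hu : |u| ≤ m) (hv : |v| ≤ m) (n : ℕ) :
    |u ^ n - v ^ n| ≤ n * m ^ (n - 1) * |u - v| := by
  have hm : 0 ≤ m := (abs_nonneg u).trans hu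
  rw [← geom_sum₂_mul u v n, abs_mul]
  refine mul_le_mul_of_nonneg_right ?_ (abs_nonneg _)
  calc |∑ i ∈ Finset.range n, u ^ i * v ^ (n - 1 - i)| ≤ ∑ i ∈ Finset.range n, |u ^ i * v ^ (n - 1 - i)| :=
        Finset.abs_sum_le_sum_abs _ _
    _ ≤ ∑ i ∈ Finset.range n, m ^ (n - 1) := by
        refine Finset.sum_le_sum fun i hi ↦ ?_
        have hi' : i < n := Finset.mem_range.1 hi
        rw [abs_mul, abs_pow, abs_pow]
        calc |u| ^ i * |v| ^ (n - 1 - i) ≤ m ^ i * m ^ (n - 1 - i) := by gcongr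
          _ = m ^ (n - 1) := by rw [← pow_add]; congr 1; omega
    _ = n * m ^ (n - 1) := by rw [Finset.sum_const, Finset.card_range, nsmul_eq_mul]

/-- For `1 ≤ y`: `|log(1/y)| = log y` and `log y ≤ 1 + log y`. -/
theorem abs_log_inv_eq {y : ℝ} (hy : 1 ≤ y) : |Real.log (1 / y)| = Real.log y := by
  rw [one_div, Real.log_inv, abs_neg, abs_of_nonneg (Real.log_nonneg hy)]

/-- **Size of the polynomial part on `[1,∞)`.** For all `a, b` there is `C` with `|Π_ab(y)| ≤ C(1+log y)^{a+b+1}` for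
`y ≥ 1`. [folklore] -/
theorem abs_polyPart_le (a b : ℕ) : ∃ C : ℝ, ∀ y : ℝ, 1 ≤ y →
    |∑ i ∈ Finset.range (a + 1), ∑ j ∈ Finset.range (b + 1),
        (a.choose i : ℝ) * (b.choose j : ℝ) * ((-1) ^ j + (-1) ^ i) *
          (∫ v in Ioc (0 : ℝ) 1, Real.log v ^ (i + j) * (v / (1 + v ^ 2) ^ 2)) *
          ((-1 / 2 : ℝ) ^ (a - i + (b - j)) * Real.log (1 / y) ^ (a - i + (b - j) + 1) /
            (((a - i + (b - j) : ℕ) : ℝ) + 1))| ≤ C * (1 + Real.log y) ^ (a + b + 1) := by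
  set μ : ℕ → ℝ := fun k ↦ ∫ v in Ioc (0 : ℝ) 1, Real.log v ^ k * (v / (1 + v ^ 2) ^ 2) with hμ
  refine ⟨∑ i ∈ Finset.range (a + 1), ∑ j ∈ Finset.range (b + 1),
      (a.choose i : ℝ) * (b.choose j : ℝ) * 2 * |μ (i + j)|, fun y hy ↦ ?_⟩
  have hL : |Real.log (1 / y)| = Real.log y := abs_log_inv_eq hy
  have hly : 0 ≤ Real.log y := Real.log_nonneg hy
  set X : ℝ := 1 + Real.log y with hX
  have hX1 : 1 ≤ X := by rw [hX]; linarith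
  rw [Finset.sum_mul]
  refine (Finset.abs_sum_le_sum_abs _ _).trans (Finset.sum_le_sum fun i hi ↦ ?_)
  rw [Finset.sum_mul]
  refine (Finset.abs_sum_le_sum_abs _ _).trans (Finset.sum_le_sum fun j hj ↦ ?_)
  have hi' : i ≤ a := Nat.lt_succ_iff.1 (Finset.mem_range.1 hi)
  have hj' : j ≤ b := Nat.lt_succ_iff.1 (Finset.mem_range.1 hj)
  set p : ℕ := a - i + (b - j) with hp
  have hpN : p + 1 ≤ a + b + 1 := by omega
  have hsign : |((-1 : ℝ) ^ j + (-1) ^ i)| ≤ 2 := by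
    calc |((-1 : ℝ) ^ j + (-1) ^ i)| ≤ |(-1 : ℝ) ^ j| + |(-1 : ℝ) ^ i| := abs_add_le _ _
      _ = 2 := by rw [abs_pow, abs_pow, abs_neg, abs_one, one_pow, one_pow]; norm_num
  have hfac : |((-1 / 2 : ℝ)) ^ p * Real.log (1 / y) ^ (p + 1) / ((p : ℝ) + 1)| ≤ X ^ (a + b + 1) := by
    rw [abs_div, abs_mul, abs_pow, abs_pow, hL, abs_of_pos (by positivity : (0 : ℝ) < (p : ℝ) + 1)]
    have h1 : |(-1 / 2 : ℝ)| ^ p ≤ 1 := by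
      rw [abs_div, abs_neg, abs_one, abs_two]; exact pow_le_one₀ (by norm_num) (by norm_num)
    have h2 : Real.log y ^ (p + 1) ≤ X ^ (a + b + 1) :=
      (pow_le_pow_left₀ hly (by rw [hX]; linarith) _).trans (pow_le_pow_right₀ hX1 hpN)
    have h3 : (1 : ℝ) ≤ (p : ℝ) + 1 := by linarith [(Nat.cast_nonneg p : (0 : ℝ) ≤ p)]
    calc |(-1 / 2 : ℝ)| ^ p * Real.log y ^ (p + 1) / ((p : ℝ) + 1) ≤ |(-1 / 2 : ℝ)| ^ p * Real.log y ^ (p + 1) :=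
          div_le_self (by positivity) h3
      _ ≤ 1 * X ^ (a + b + 1) := by gcongr
      _ = X ^ (a + b + 1) := one_mul _
  rw [abs_mul, abs_mul, abs_mul, abs_mul, Nat.abs_cast, Nat.abs_cast]
  simp only [hμ] at hfac ⊢
  calc (a.choose i : ℝ) * (b.choose j : ℝ) * |((-1 : ℝ) ^ j + (-1) ^ i)| * |μ (i + j)| *
        |((-1 / 2 : ℝ)) ^ (a - i + (b - j)) * Real.log (1 / y) ^ (a - i + (b - j) + 1) / (((a - i + (b - j) : ℕ) : ℝ) + 1)|
      ≤ (a.choose i : ℝ) * (b.choose j : ℝ) * 2 * |μ (i + j)| * X ^ (a + b + 1) := by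
        gcongr

/-- **Variation of the polynomial part on `[1,∞)`.** For all `a, b` there is `C` with
`|Π_ab(y₁) − Π_ab(y₂)| ≤ C(1+log y₂)^{a+b+1}(y₂−y₁)/y₁` for `1 ≤ y₁ ≤ y₂`. [folklore] -/
theorem abs_polyPart_sub_le (a b : ℕ) : ∃ C : ℝ, ∀ y₁ y₂ : ℝ, 1 ≤ y₁ → y₁ ≤ y₂ →
    |(∑ i ∈ Finset.range (a + 1), ∑ j ∈ Finset.range (b + 1),
        (a.choose i : ℝ) * (b.choose j : ℝ) * ((-1) ^ j + (-1) ^ i) *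
          (∫ v in Ioc (0 : ℝ) 1, Real.log v ^ (i + j) * (v / (1 + v ^ 2) ^ 2)) *
          ((-1 / 2 : ℝ) ^ (a - i + (b - j)) * Real.log (1 / y₁) ^ (a - i + (b - j) + 1) /
            (((a - i + (b - j) : ℕ) : ℝ) + 1))) -
      ∑ i ∈ Finset.range (a + 1), ∑ j ∈ Finset.range (b + 1),
        (a.choose i : ℝ) * (b.choose j : ℝ) * ((-1) ^ j + (-1) ^ i) *
          (∫ v in Ioc (0 : ℝ) 1, Real.log v ^ (i + j) * (v / (1 + v ^ 2) ^ 2)) *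
          ((-1 / 2 : ℝ) ^ (a - i + (b - j)) * Real.log (1 / y₂) ^ (a - i + (b - j) + 1) /
            (((a - i + (b - j) : ℕ) : ℝ) + 1))| ≤ C * (1 + Real.log y₂) ^ (a + b + 1) * (y₂ - y₁) / y₁ := by
  set μ : ℕ → ℝ := fun k ↦ ∫ v in Ioc (0 : ℝ) 1, Real.log v ^ k * (v / (1 + v ^ 2) ^ 2) with hμ
  refine ⟨∑ i ∈ Finset.range (a + 1), ∑ j ∈ Finset.range (b + 1),
      (a.choose i : ℝ) * (b.choose j : ℝ) * 2 * |μ (i + j)|, fun y₁ y₂ hy₁ h12 ↦ ?_⟩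
  have hy₂ : 1 ≤ y₂ := hy₁.trans h12
  have hy₁0 : 0 < y₁ := one_pos.trans_le hy₁
  have hL1 : |Real.log (1 / y₁)| = Real.log y₁ := abs_log_inv_eq hy₁
  have hL2 : |Real.log (1 / y₂)| = Real.log y₂ := abs_log_inv_eq hy₂
  have hl1 : 0 ≤ Real.log y₁ := Real.log_nonneg hy₁
  have hl12 : Real.log y₁ ≤ Real.log y₂ := Real.log_le_log hy₁0 h12
  set X : ℝ := 1 + Real.log y₂ with hX
  have hX1 : 1 ≤ X := by rw [hX]; linarith
  set δ : ℝ := (y₂ - y₁) / y₁ with hδ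
  have hδ0 : 0 ≤ δ := div_nonneg (by linarith) hy₁0.le
  have hLdiff : |Real.log (1 / y₁) - Real.log (1 / y₂)| ≤ δ := by
    rw [one_div, one_div, Real.log_inv, Real.log_inv, neg_sub_neg, ← Real.log_div (by linarith) hy₁0.ne',
      abs_of_nonneg (Real.log_nonneg ((one_le_div hy₁0).2 h12))]
    have h := Real.log_le_sub_one_of_pos (by positivity : (0 : ℝ) < y₂ / y₁)
    rw [hδ, sub_div, div_self hy₁0.ne']
    exact h
  rw [← Finset.sum_sub_distrib, Finset.sum_mul, Finset.sum_mul, Finset.sum_div]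
  refine (Finset.abs_sum_le_sum_abs _ _).trans (Finset.sum_le_sum fun i hi ↦ ?_)
  rw [← Finset.sum_sub_distrib, Finset.sum_mul, Finset.sum_mul, Finset.sum_div]
  refine (Finset.abs_sum_le_sum_abs _ _).trans (Finset.sum_le_sum fun j hj ↦ ?_)
  have hi' : i ≤ a := Nat.lt_succ_iff.1 (Finset.mem_range.1 hi)
  have hj' : j ≤ b := Nat.lt_succ_iff.1 (Finset.mem_range.1 hj)
  set p : ℕ := a - i + (b - j) with hp
  have hpN : p + 1 ≤ a + b + 1 := by omega
  have hsign : |((-1 : ℝ) ^ j + (-1) ^ i)| ≤ 2 := by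
    calc |((-1 : ℝ) ^ j + (-1) ^ i)| ≤ |(-1 : ℝ) ^ j| + |(-1 : ℝ) ^ i| := abs_add_le _ _
      _ = 2 := by rw [abs_pow, abs_pow, abs_neg, abs_one, one_pow, one_pow]; norm_num
  -- the power difference
  have hpow : |Real.log (1 / y₁) ^ (p + 1) - Real.log (1 / y₂) ^ (p + 1)| ≤ ((p : ℝ) + 1) * X ^ (a + b + 1) * δ := by
    have h := abs_pow_sub_pow_le_of_abs_le (u := Real.log (1 / y₁)) (v := Real.log (1 / y₂)) (m := Real.log y₂)
      (by rw [hL1]; exact hl12) (by rw [hL2]) (p + 1)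
    rw [Nat.add_sub_cancel] at h
    have hm : Real.log y₂ ^ p ≤ X ^ (a + b + 1) := by
      calc Real.log y₂ ^ p ≤ X ^ p := pow_le_pow_left₀ (hl1.trans hl12) (by rw [hX]; linarith) p
        _ ≤ X ^ (a + b + 1) := pow_le_pow_right₀ hX1 (by omega)
    calc _ ≤ ((p + 1 : ℕ) : ℝ) * Real.log y₂ ^ p * |Real.log (1 / y₁) - Real.log (1 / y₂)| := h
      _ ≤ ((p : ℝ) + 1) * X ^ (a + b + 1) * δ := by
          push_cast
          gcongr
  rw [← mul_sub, ← sub_div, ← mul_sub, abs_mul, abs_mul, abs_mul, abs_mul, Nat.abs_cast, Nat.abs_cast, abs_div,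
    abs_mul, abs_pow, abs_of_pos (by positivity : (0 : ℝ) < (p : ℝ) + 1)]
  have h12' : |(-1 / 2 : ℝ)| ^ p ≤ 1 := by
    rw [abs_div, abs_neg, abs_one, abs_two]; exact pow_le_one₀ (by norm_num) (by norm_num)
  simp only [hμ] at *
  calc (a.choose i : ℝ) * (b.choose j : ℝ) * |((-1 : ℝ) ^ j + (-1) ^ i)| * |μ (i + j)| *
        (|(-1 / 2 : ℝ)| ^ p * |Real.log (1 / y₁) ^ (p + 1) - Real.log (1 / y₂) ^ (p + 1)| / ((p : ℝ) + 1))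
      ≤ (a.choose i : ℝ) * (b.choose j : ℝ) * 2 * |μ (i + j)| * (1 * (((p : ℝ) + 1) * X ^ (a + b + 1) * δ) / ((p : ℝ) + 1)) := by
        gcongr
    _ = (a.choose i : ℝ) * (b.choose j : ℝ) * 2 * |μ (i + j)| * X ^ (a + b + 1) * (y₂ - y₁) / y₁ := by
        rw [hδ]; field_simp

/-- The Bose coefficient is bounded on `[1, ∞)`: `|c_ab(y)| ≤ (1−e^{−1})^{−2}M′_aM′_b` for `y ≥ 1`. [folklore] -/
theorem abs_bose_coeff_le_of_one_le (a b : ℕ) {y : ℝ} (hy : 1 ≤ y) :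
    |∫ u₁ in Ioi (0 : ℝ), Real.log u₁ ^ a *
        ∫ u₂ in Ioi (y / u₁), Real.exp (-(u₁ + u₂)) / (1 - Real.exp (-(u₁ + u₂))) ^ 2 * Real.log u₂ ^ b| ≤
      ((1 - Real.exp (-1)) ^ 2)⁻¹ *
        (∫ u in Ioi (0 : ℝ), Real.exp (-(u / 2)) * |Real.log u| ^ a) *
        (∫ u in Ioi (0 : ℝ), Real.exp (-(u / 2)) * |Real.log u| ^ b) := by
  have hy0 : 0 < y := one_pos.trans_le hy
  have h := abs_bose_coeff_le hy0 a b
  have hMa : 0 ≤ ∫ u in Ioi (0 : ℝ), Real.exp (-(u / 2)) * |Real.log u| ^ a :=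
    setIntegral_nonneg measurableSet_Ioi fun u _ ↦ by positivity
  have hMb : 0 ≤ ∫ u in Ioi (0 : ℝ), Real.exp (-(u / 2)) * |Real.log u| ^ b :=
    setIntegral_nonneg measurableSet_Ioi fun u _ ↦ by positivity
  have hs : 1 ≤ Real.sqrt y := by rw [show (1 : ℝ) = Real.sqrt 1 from Real.sqrt_one.symm]; exact Real.sqrt_le_sqrt hy
  have he : Real.exp (-Real.sqrt y) ≤ Real.exp (-1) := Real.exp_le_exp.2 (by linarith)
  have he1 : Real.exp (-1) < 1 := by
    have h' : Real.exp (-1) < Real.exp 0 := Real.exp_lt_exp.2 (by norm_num)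
    rwa [Real.exp_zero] at h'
  have hd : (1 - Real.exp (-1)) ^ 2 ≤ (1 - Real.exp (-Real.sqrt y)) ^ 2 :=
    pow_le_pow_left₀ (by linarith) (by linarith) 2
  have hinv : ((1 - Real.exp (-Real.sqrt y)) ^ 2)⁻¹ ≤ ((1 - Real.exp (-1)) ^ 2)⁻¹ :=
    inv_anti₀ (by nlinarith) hd
  have hexp1 : Real.exp (-Real.sqrt y) ≤ 1 := by
    have := Real.exp_le_exp.2 (show -Real.sqrt y ≤ 0 by linarith); rwa [Real.exp_zero] at this
  calc _ ≤ _ := h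
    _ ≤ ((1 - Real.exp (-1)) ^ 2)⁻¹ * 1 *
        (∫ u in Ioi (0 : ℝ), Real.exp (-(u / 2)) * |Real.log u| ^ a) *
        (∫ u in Ioi (0 : ℝ), Real.exp (-(u / 2)) * |Real.log u| ^ b) := by
        gcongr
    _ = _ := by rw [mul_one]

/-- **Size of the continued remainder on `[1,∞)`.** For all `a, b` there is `C` such that for `y ≥ 1`:
`|c_ab(y) − (c_ab(1) + A_ab + Π_ab(y))| ≤ C(1+log y)^{a+b+1}`.
[cite: KowalskiMichelVanderKam2000, (22)–(28) — derivation (remainder of the diagonal weight beyond the box)] -/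
theorem abs_bose_rem_tail_le (a b : ℕ) : ∃ C : ℝ, ∀ y : ℝ, 1 ≤ y →
    |(∫ u₁ in Ioi (0 : ℝ), Real.log u₁ ^ a *
        ∫ u₂ in Ioi (y / u₁), Real.exp (-(u₁ + u₂)) / (1 - Real.exp (-(u₁ + u₂))) ^ 2 * Real.log u₂ ^ b) -
      ((∫ u₁ in Ioi (0 : ℝ), Real.log u₁ ^ a *
          ∫ u₂ in Ioi (1 / u₁), Real.exp (-(u₁ + u₂)) / (1 - Real.exp (-(u₁ + u₂))) ^ 2 * Real.log u₂ ^ b) +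
        (∫ η in Ioc (0 : ℝ) 1, (η * (∫ u in Ioi (0 : ℝ), Real.log u ^ a * Real.log (η / u) ^ b *
            (Real.exp (-(u + η / u)) / (1 - Real.exp (-(u + η / u))) ^ 2) / u) -
          ∫ v in Ioc (0 : ℝ) 1, ((-(Real.log (1 / η) / 2) + Real.log v) ^ a * (-(Real.log (1 / η) / 2) - Real.log v) ^ b +
              (-(Real.log (1 / η) / 2) - Real.log v) ^ a * (-(Real.log (1 / η) / 2) + Real.log v) ^ b) *
            (v / (1 + v ^ 2) ^ 2)) / η) +
        ∑ i ∈ Finset.range (a + 1), ∑ j ∈ Finset.range (b + 1),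
          (a.choose i : ℝ) * (b.choose j : ℝ) * ((-1) ^ j + (-1) ^ i) *
            (∫ v in Ioc (0 : ℝ) 1, Real.log v ^ (i + j) * (v / (1 + v ^ 2) ^ 2)) *
            ((-1 / 2 : ℝ) ^ (a - i + (b - j)) * Real.log (1 / y) ^ (a - i + (b - j) + 1) /
              (((a - i + (b - j) : ℕ) : ℝ) + 1)))| ≤ C * (1 + Real.log y) ^ (a + b + 1) := by
  obtain ⟨CP, hCP⟩ := abs_polyPart_le a b
  set D : ℝ := ((1 - Real.exp (-1)) ^ 2)⁻¹ *
        (∫ u in Ioi (0 : ℝ), Real.exp (-(u / 2)) * |Real.log u| ^ a) *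
        (∫ u in Ioi (0 : ℝ), Real.exp (-(u / 2)) * |Real.log u| ^ b) with hD
  set A : ℝ := ∫ η in Ioc (0 : ℝ) 1, (η * (∫ u in Ioi (0 : ℝ), Real.log u ^ a * Real.log (η / u) ^ b *
            (Real.exp (-(u + η / u)) / (1 - Real.exp (-(u + η / u))) ^ 2) / u) -
          ∫ v in Ioc (0 : ℝ) 1, ((-(Real.log (1 / η) / 2) + Real.log v) ^ a * (-(Real.log (1 / η) / 2) - Real.log v) ^ b +
              (-(Real.log (1 / η) / 2) - Real.log v) ^ a * (-(Real.log (1 / η) / 2) + Real.log v) ^ b) *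
            (v / (1 + v ^ 2) ^ 2)) / η with hA
  have hD0 : 0 ≤ D := (abs_nonneg _).trans (abs_bose_coeff_le_of_one_le a b le_rfl)
  have hCP0 : 0 ≤ CP := by
    have h := hCP 1 le_rfl
    have : (0 : ℝ) ≤ CP * (1 + Real.log 1) ^ (a + b + 1) := (abs_nonneg _).trans h
    simpa using this
  refine ⟨2 * D + |A| + CP, fun y hy ↦ ?_⟩
  have hly : 0 ≤ Real.log y := Real.log_nonneg hy
  have hX1 : 1 ≤ (1 + Real.log y) ^ (a + b + 1) := one_le_pow₀ (by linarith)
  have h1 := abs_bose_coeff_le_of_one_le a b hy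
  have h2 := abs_bose_coeff_le_of_one_le a b le_rfl
  have h3 := hCP y hy
  rw [← hD] at h1 h2
  calc _ ≤ |∫ u₁ in Ioi (0 : ℝ), Real.log u₁ ^ a *
          ∫ u₂ in Ioi (y / u₁), Real.exp (-(u₁ + u₂)) / (1 - Real.exp (-(u₁ + u₂))) ^ 2 * Real.log u₂ ^ b| +
        (|∫ u₁ in Ioi (0 : ℝ), Real.log u₁ ^ a *
          ∫ u₂ in Ioi (1 / u₁), Real.exp (-(u₁ + u₂)) / (1 - Real.exp (-(u₁ + u₂))) ^ 2 * Real.log u₂ ^ b| + |A| +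
        |∑ i ∈ Finset.range (a + 1), ∑ j ∈ Finset.range (b + 1),
          (a.choose i : ℝ) * (b.choose j : ℝ) * ((-1) ^ j + (-1) ^ i) *
            (∫ v in Ioc (0 : ℝ) 1, Real.log v ^ (i + j) * (v / (1 + v ^ 2) ^ 2)) *
            ((-1 / 2 : ℝ) ^ (a - i + (b - j)) * Real.log (1 / y) ^ (a - i + (b - j) + 1) /
              (((a - i + (b - j) : ℕ) : ℝ) + 1))|) := by
        refine (abs_sub _ _).trans (add_le_add le_rfl ?_)
        exact (abs_add_le _ _).trans (add_le_add (abs_add_le _ _) le_rfl)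
    _ ≤ D + (D + |A| + CP * (1 + Real.log y) ^ (a + b + 1)) := by gcongr
    _ ≤ (2 * D + |A| + CP) * (1 + Real.log y) ^ (a + b + 1) := by
        nlinarith [mul_le_mul_of_nonneg_left hX1 hD0, mul_le_mul_of_nonneg_left hX1 (abs_nonneg A)]

/-- **Variation of the continued remainder on `[1,∞)`.** For all `a, b` there is `C` such that for `1 ≤ y₁ ≤ y₂`:
`|r_ab(y₁) − r_ab(y₂)| ≤ C(1+log y₂)^{a+b+1}(y₂−y₁)/y₁`, where `r_ab(y) = c_ab(y) − c_ab(1) − A_ab − Π_ab(y)` (the constant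
terms cancel: `r_ab(y₁) − r_ab(y₂) = (c_ab(y₁) − c_ab(y₂)) − (Π_ab(y₁) − Π_ab(y₂))`).
[cite: KowalskiMichelVanderKam2000, (22)–(28) — derivation (remainder of the diagonal weight beyond the box)] -/
theorem abs_bose_rem_tail_sub_le (a b : ℕ) : ∃ C : ℝ, ∀ y₁ y₂ : ℝ, 1 ≤ y₁ → y₁ ≤ y₂ →
    |((∫ u₁ in Ioi (0 : ℝ), Real.log u₁ ^ a *
        ∫ u₂ in Ioi (y₁ / u₁), Real.exp (-(u₁ + u₂)) / (1 - Real.exp (-(u₁ + u₂))) ^ 2 * Real.log u₂ ^ b) -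
      (∫ u₁ in Ioi (0 : ℝ), Real.log u₁ ^ a *
        ∫ u₂ in Ioi (y₂ / u₁), Real.exp (-(u₁ + u₂)) / (1 - Real.exp (-(u₁ + u₂))) ^ 2 * Real.log u₂ ^ b)) -
      ((∑ i ∈ Finset.range (a + 1), ∑ j ∈ Finset.range (b + 1),
        (a.choose i : ℝ) * (b.choose j : ℝ) * ((-1) ^ j + (-1) ^ i) *
          (∫ v in Ioc (0 : ℝ) 1, Real.log v ^ (i + j) * (v / (1 + v ^ 2) ^ 2)) *
          ((-1 / 2 : ℝ) ^ (a - i + (b - j)) * Real.log (1 / y₁) ^ (a - i + (b - j) + 1) /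
            (((a - i + (b - j) : ℕ) : ℝ) + 1))) -
      ∑ i ∈ Finset.range (a + 1), ∑ j ∈ Finset.range (b + 1),
        (a.choose i : ℝ) * (b.choose j : ℝ) * ((-1) ^ j + (-1) ^ i) *
          (∫ v in Ioc (0 : ℝ) 1, Real.log v ^ (i + j) * (v / (1 + v ^ 2) ^ 2)) *
          ((-1 / 2 : ℝ) ^ (a - i + (b - j)) * Real.log (1 / y₂) ^ (a - i + (b - j) + 1) /
            (((a - i + (b - j) : ℕ) : ℝ) + 1)))| ≤ C * (1 + Real.log y₂) ^ (a + b + 1) * (y₂ - y₁) / y₁ := by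
  obtain ⟨CT, hCT⟩ := abs_bose_coeff_sub_le_of_one_le a b
  obtain ⟨CP, hCP⟩ := abs_polyPart_sub_le a b
  have hCT0 : 0 ≤ CT := by
    have h := hCT 1 2 le_rfl (by norm_num)
    have h2 : (0 : ℝ) < (1 + |Real.log 2|) ^ (a + b) * (2 - 1) / 1 := by positivity
    have h3 : 0 ≤ CT * ((1 + |Real.log 2|) ^ (a + b) * (2 - 1) / 1) := by
      have := (abs_nonneg _).trans h
      simpa [mul_assoc, mul_div_assoc] using this
    exact nonneg_of_mul_nonneg_left h3 h2
  refine ⟨CT + CP, fun y₁ y₂ hy₁ h12 ↦ ?_⟩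
  have hy₂ : 1 ≤ y₂ := hy₁.trans h12
  have hy₁0 : 0 < y₁ := one_pos.trans_le hy₁
  have hl2 : 0 ≤ Real.log y₂ := Real.log_nonneg hy₂
  have h1 := hCT y₁ y₂ hy₁ h12
  have h2 := hCP y₁ y₂ hy₁ h12
  rw [abs_of_nonneg hl2] at h1
  have hpow : (1 + Real.log y₂) ^ (a + b) ≤ (1 + Real.log y₂) ^ (a + b + 1) :=
    pow_le_pow_right₀ (by linarith) (by omega)
  have hδ0 : 0 ≤ (y₂ - y₁) / y₁ := div_nonneg (by linarith) hy₁0.le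
  calc _ ≤ CT * (1 + Real.log y₂) ^ (a + b) * (y₂ - y₁) / y₁ + CP * (1 + Real.log y₂) ^ (a + b + 1) * (y₂ - y₁) / y₁ :=
        (abs_sub _ _).trans (add_le_add h1 h2)
    _ ≤ CT * (1 + Real.log y₂) ^ (a + b + 1) * (y₂ - y₁) / y₁ + CP * (1 + Real.log y₂) ^ (a + b + 1) * (y₂ - y₁) / y₁ := by
        have : CT * (1 + Real.log y₂) ^ (a + b) * ((y₂ - y₁) / y₁) ≤
            CT * (1 + Real.log y₂) ^ (a + b + 1) * ((y₂ - y₁) / y₁) := by gcongr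
        rw [mul_div_assoc, mul_div_assoc (CT * _)]
        linarith
    _ = (CT + CP) * (1 + Real.log y₂) ^ (a + b + 1) * (y₂ - y₁) / y₁ := by ring

end Summit.Parity.GeneralizedHardyLittlewood.Theorems.MomentsBeyondDiagonal.DiagLines

end
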